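/-
COR-CM (cells pub-hodgecm / pub-hodgecm2, stage 2 of the Hodge ladder) — TRANSPOSITION SURGE, item (vi) sub-binder S2, TEAM hComp:
**NON-VACUITY OF THE POSITED CARRIER BINDERS `C`, `R` AT EVERY INDEX** — the Π-types
`∀ F ι₁ V Φ, Sec42Data (Model.honestP5Of h F ι₁ V Φ) (iso F ι₁ V Φ)` and `∀ F ι₁ V Φ, Thm418Rest (C F ι₁ V Φ)` quantified by
the END displays (`Item6PinReachClosed.lean` :63, `Item6SupplyPinnedAssemblyAlongHolds.lean` §3 :250) are INHABITED, including the
never-read branch `[F:ℚ] = 2` of b25's total datum (the punctured plane; hcomp-lead RULING F1′, hcomp-ref R-5 — until now «in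
principle»).  Seat prover-pub-hodgecm2-pin-1-g3-0 (pin-1 gen 3, owner of record of `hComp`).  THEOREMS ONLY (no
definition, no instance, no named fact); hypothesis binders = the named facts `h : exists_recordSystem` ([Deligne1979] 2.2.5 / Cor. 2.7.21) and `hA : Liu2021.exists_albanese`
([Liu2021] §2.1 Prop. 2.2).  Nothing landed is edited or restated.  FRAMING: HC_CM is NOT proved; S2 is NOT closed; nothing here
discharges any reading binder — it certifies that the displays quantify over NON-EMPTY carrier types (and hence that a TOTAL carrier
term `fun F ι₁ V Φ => Classical.choice (nonempty_sec42Data_honestP5Of_all …)`, at which `C` could be instantiated, EXISTS).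
-/
import Summits.HodgeConjecture.CorCM.B01.Transposition.HComp.PuncturedPlane
import Summits.HodgeConjecture.CorCM.B01.Transposition.HComp.HonestP5OfNonVacuity
import HarnessLib

/-!
# TEAM hComp: the carrier binders `C`, `R` over `honestP5Of h` are inhabited at ALL `(F, ι₁, V, Φ)`

b25's `HComp/HonestP5OfNonVacuity.lean` (p310637) inhabits `Sec42Data (honestP5Of h F ι₁ V Φ) iso` for `4 ≤ [F:ℚ]` (Compact Case:
`X_K = Sh(𝕍)_K` projective).  At `[F:ℚ] = 2` the total record functor is the constant system at the punctured plane
`ℙ²_F ∖ {[0:0:1]}` (`Model.recordFunctorOf`, `dif_neg`), for which `HComp/PuncturedPlane.lean` (pin-1) proves what the TYPED §4.2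
attributes ask of a Noncompact-Case `Sh(𝕍)_K` ([Liu2021] §4.2 l. 2055–2064: smooth, NOT projective, open in a smooth projective `X_K` with
finitely many boundary points).  Here:

* §1 base change along the CM conjugation `c` (an automorphism, so `Spec c` is an isomorphism): non-properness, open immersions and
  one-point boundaries survive `⊗_{F,c}` (`not_isProper_baseChange_cmConj`, `isOpenImmersion_baseChange_map_left`,
  `subsingleton_compl_range_baseChange_map`);
* §2 `nonempty_sec42Data_punctured` — a `CompactifiedSystem` on the constant punctured system, built inside the proof: it satisfies the
  TYPED fields of `CompactifiedSystem` (Def. C.8 AS TYPED in `AppendixC/Glue.lean` :297–329: `\overline{Sh} := X := ℙ²_F ⊗_c F` smooth projective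
  (tree `isSmoothProjective_projectiveSpace_holds`), `j = jBar :=` the base-changed open immersion, `blowDown := 𝟙`, boundary ONE point hence
  discrete) and NOTHING MORE — it is NOT Liu's toroidal compactification ([Liu2021] l. 4656–4670: blow-up of the Baily–Borel compactification at
  isolated singular points, boundary a smooth divisor), which the typed structure does not demand (hcomp-ref g17 register note, HOME/INBOX
  l.6850); «projective iff Compact Case» FALSE ⟺ FALSE at `d = [F⁺:ℚ] = 1`, `n = 3` ([Liu2021] l. 2060); hence
  `nonempty_sec42Data_honestP5Of_of_not_four_le` and, with b25's theorem, **`nonempty_sec42Data_honestP5Of_all`** (every `F`);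
* §3 `nonempty_thm418Rest` — the TYPE `Thm418Rest C` is inhabited over any `C` (a conjugate-symplectic weight-one `μ` from the
  tree THEOREM `IdeleClassGroup.exists_isConjugateSymplectic_hasCMType`, `Obj := PUnit` with `A_μ := A_{K₀}`, `ω := ℂ`, `Ω := PUnit`,
  `res := 0`) — an inhabitant of the carrier TYPE, no claim about Liu's actual theta-lift objects (X3 lineage);
* §4 **`Model.nonempty_piCarriers`**: the Π-binders `iso`, `C`, `R` of the END displays are JOINTLY inhabited — by the TOTAL term
  `fun F ι₁ V Φ => Classical.choice (nonempty_sec42Data_honestP5Of_all h V Φ hA (iso F ι₁ V Φ))` (no degree guard) and a `Thm418Rest` over it.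

CITE STATUS: the certificate is CONDITIONAL on `hA : Liu2021.exists_albanese` ([Liu2021] §2.1 Prop. 2.2 as printed,
`Liu2021/AlbaneseBaseChange.lean` :107 — b25's NV cite), a cite the END displays themselves do NOT take (their Albanese binder is
`albanese_baseChange_isLimit_fan_jacobian`); it stays off every display's binder list unless `C` is instantiated (CARRIERS-PLAN S5/S7).
T5: binders {`h`, `hA`} (+ data) — line requested on the filed sha.  HC_CM is NOT proved.

References: [Liu2021] Y. Liu, arXiv:2102.11518, §2.1 Prop. 2.2 l. 1190–1200, §4.2 l. 2053–2074, Def. 4.3, Def. 4.5 (2), App. C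
l. 4656–4670, Def. C.8; [Deligne1979] 2.2.5, Cor. 2.7.21; A. Weil, *Basic Number Theory* (1967) VII §3 (Hecke characters).
-/

noncomputable section

open CategoryTheory CategoryTheory.Limits AlgebraicGeometry NumberField
open Literature.AlgebraicGeometry.Motives
open Literature.AlgebraicGeometry.ShimuraVarieties.UnitaryCanonicalModel
open Literature.NumberTheory.Automorphic
open Literature.NumberTheory.Automorphic.Liu2021
open Literature.NumberTheory.Automorphic.Liu2021.AppendixC
open Summit.HodgeConjecture.CorCM.HComp
open Summit.HodgeConjecture.CorCM.HComp.PuncturedPlane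

namespace Summit.HodgeConjecture.CorCM.Model

/-! ## §1  Base change along the CM conjugation `c : F → F` -/

section BaseChangeConj

variable (F : CMField)

/-- `Spec c` is an isomorphism (`c` is a ring automorphism of `F`). [folklore] -/
theorem isIso_specMap_cmConjRingHom : IsIso (Spec.map (CommRingCat.ofHom (cmConjRingHom F))) := by
  have : IsIso (CommRingCat.ofHom (cmConjRingHom F)) :=
    (inferInstance : IsIso (IsCMField.complexConj (F : Type)).toRingEquiv.toCommRingCatIso.hom)
  infer_instance

variable {F}

/-- The projection `X ⊗_{F,c} F ⟶ X` is an isomorphism of schemes (base change of the isomorphism `Spec c`). [folklore] -/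
theorem isIso_baseChangeHomFst_cmConj (X : SchemeOver F) : IsIso (baseChangeHomFst (cmConjRingHom F) X) :=
  haveI := isIso_specMap_cmConjRingHom F
  inferInstanceAs (IsIso (pullback.fst X.hom (Spec.map (CommRingCat.ofHom (cmConjRingHom F)))))

/-- **Non-properness survives `⊗_{F,c} F`**: if `X → Spec F` is not proper then neither is `X ⊗_{F,c} F → Spec F`
(`X ⊗_c F ⟶ X` and `Spec c` are isomorphisms; Mathlib `MorphismProperty.cancel_*_of_respectsIso`). [folklore] -/
theorem not_isProper_baseChange_cmConj {X : SchemeOver F} (hX : ¬ IsProper X.hom) :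
    ¬ IsProper ((baseChangeHom (cmConjRingHom F)).obj X).hom := by
  haveI := isIso_specMap_cmConjRingHom F
  intro h
  apply hX
  rw [baseChangeHom_obj_hom] at h
  have h' : IsProper (pullback.snd X.hom (Spec.map (CommRingCat.ofHom (cmConjRingHom F))) ≫
      Spec.map (CommRingCat.ofHom (cmConjRingHom F))) :=
    (MorphismProperty.cancel_right_of_respectsIso @IsProper _ _).mpr h
  rw [← pullback.condition] at h'
  exact (MorphismProperty.cancel_left_of_respectsIso @IsProper _ _).mp h'

/-- Open immersions survive `⊗_{F,c} F` (base change; tree `isPullback_baseChange_map_left`). [folklore] -/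
theorem isOpenImmersion_baseChange_map_left {X Y : SchemeOver F} (f : X ⟶ Y) [hf : IsOpenImmersion f.left] :
    IsOpenImmersion ((baseChangeHom (cmConjRingHom F)).map f).left :=
  letI : Algebra F F := (cmConjRingHom F).toAlgebra
  MorphismProperty.IsStableUnderBaseChange.of_isPullback (isPullback_baseChange_map_left (F : Type) f).flip hf

/-- **A one-point boundary survives `⊗_{F,c} F`**: if the complement of the image of `f : X ⟶ Y` is a subsingleton, so is the
complement of the image of `f ⊗_c F` (the projections `X ⊗_c F ⟶ X`, `Y ⊗_c F ⟶ Y` are bijections commuting with `f`). [folklore] -/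
theorem subsingleton_compl_range_baseChange_map {X Y : SchemeOver F} (f : X ⟶ Y)
    (hf : ((Set.range f.left)ᶜ).Subsingleton) :
    ((Set.range ((baseChangeHom (cmConjRingHom F)).map f).left)ᶜ).Subsingleton := by
  set σ := cmConjRingHom F
  haveI := isIso_baseChangeHomFst_cmConj X
  haveI := isIso_baseChangeHomFst_cmConj Y
  have hsq : ((baseChangeHom σ).map f).left ≫ baseChangeHomFst σ Y = baseChangeHomFst σ X ≫ f.left :=
    baseChangeHom_map_left_comp_fst σ f
  let eX := Scheme.homeoOfIso (asIso (baseChangeHomFst σ X))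
  let eY := Scheme.homeoOfIso (asIso (baseChangeHomFst σ Y))
  have hcomm : ∀ z, eY (((baseChangeHom σ).map f).left z) = f.left (eX z) := fun z => by
    change (((baseChangeHom σ).map f).left ≫ baseChangeHomFst σ Y) z = (baseChangeHomFst σ X ≫ f.left) z
    rw [hsq]
  intro x hx y hy
  apply eY.injective
  apply hf
  · intro ⟨u, hu⟩
    obtain ⟨u', rfl⟩ := eX.surjective u
    exact hx ⟨u', eY.injective (by rw [hcomm, hu])⟩
  · intro ⟨u, hu⟩
    obtain ⟨u', rfl⟩ := eX.surjective u
    exact hy ⟨u', eY.injective (by rw [hcomm, hu])⟩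

end BaseChangeConj

/-! ## §2  Def. C.8 on the constant punctured system, and `Sec42Data` at `[F:ℚ] = 2` -/

section Punctured

variable {F : CMField} {ι₁ : F →+* ℂ} (V : HermSpace3 F ι₁) (K₀ : C5.OpenCompactSubgroup ↥V.adelicFin)

/-- `recordFunctorOf h V` IS the constant punctured system when `¬ 4 ≤ [F:ℚ]` (`dif_neg`). [cite: Liu2021, §4.2 l. 2053–2060] -/
theorem recordFunctorOf_eq_punctured (h : exists_recordSystem) (h4 : ¬ 4 ≤ Module.finrank ℚ F) :
    recordFunctorOf h V = (Functor.const _).obj (puncturedPlane F) :=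
  dif_neg h4

omit ι₁ V in
/-- A CM field with `¬ 4 ≤ [F:ℚ]` is imaginary quadratic: `d = [F⁺:ℚ] = 1` (`[F:ℚ] = 2·[F⁺:ℚ]`). [cite: Liu2021, §4.2 l. 2053–2057] -/
theorem finrank_maximalRealSubfield_eq_one (h4 : ¬ 4 ≤ Module.finrank ℚ F) :
    Module.finrank ℚ (maximalRealSubfield F) = 1 := by
  have hmul := Module.finrank_mul_finrank ℚ (maximalRealSubfield F) F
  rw [Algebra.IsQuadraticExtension.finrank_eq_two (maximalRealSubfield F) F] at hmul
  have hpos : 0 < Module.finrank ℚ (maximalRealSubfield F) := Module.finrank_pos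
  omega

/-- `X_K = (ℙ²_F ∖ pt) ⊗_c F` of the constant punctured system is NOT projective over `F`. [cite: Liu2021, §4.2 l. 2060] -/
theorem not_isProjectiveOver_punctured_Sh (K : C5.SmallLevel K₀) :
    ¬ IsProjectiveOver ((honestSystem V K₀ ((Functor.const _).obj (puncturedPlane F))).Sh𝕍.obj K) := fun hK =>
  not_isProper_baseChange_cmConj (not_isProper_puncturedPlane F) hK.isProper

/-- «projective iff Compact Case» ([Liu2021] §4.2 l. 2060) for the punctured system at `d = 1`, `n = 3`: both sides FALSE.
[cite: Liu2021, §4.2 l. 2053–2060] -/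
theorem isProjectiveOver_punctured_Sh_iff (hd : Module.finrank ℚ (maximalRealSubfield F) = 1) (iso : ℕ → Prop)
    (K : C5.SmallLevel K₀) :
    IsProjectiveOver ((honestSystem V K₀ ((Functor.const _).obj (puncturedPlane F))).Sh𝕍.obj K) ↔
      ¬ (Module.finrank ℚ (maximalRealSubfield F) = 1 ∧
        (3 ≤ (honestP5 V K₀ ((Functor.const _).obj (puncturedPlane F))).n ∨
          ((honestP5 V K₀ ((Functor.const _).obj (puncturedPlane F))).n = 2 ∧ ∀ p : ℕ, p.Prime → iso p))) :=
  ⟨fun hK => absurd hK (not_isProjectiveOver_punctured_Sh V K₀ K), fun hK => absurd ⟨hd, Or.inl le_rfl⟩ hK⟩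

/-- **`Sec42Data` over the constant punctured system.**  A `CompactifiedSystem` satisfying the TYPED fields of Def. C.8
(`AppendixC/Glue.lean` :297–329) and nothing more — `\overline{Sh}(𝕍)_K := X_K := ℙ²_F ⊗_c F` (smooth projective, tree
`isSmoothProjective_projectiveSpace_holds`), `jBar = j :=` the open immersion `(ℙ² ∖ pt) ⊗_c F ↪ ℙ² ⊗_c F` (base change of pin-1's
`exists_openImmersion_puncturedPlane`), `blowDown := 𝟙`, boundary one point (discrete), «if `Sh(𝕍)_K` is proper then …» vacuous (it is not),
«projective if `d > 1` or `n = 1`» vacuous at `d = 1`, `n = 3`; NOT Liu's toroidal compactification of l. 4656–4670 (blow-up of Baily–Borel,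
boundary a smooth divisor), which the typed structure does not demand — then the Albanese data of the proper smooth `X_K` from [Liu2021] §2.1
Prop. 2.2 as printed (`exists_albanese`; tree assembly `Sec42Data.nonempty_of_exists_albanese`).
[cite: Liu2021, §4.2 l. 2053–2072, §2.1 Prop. 2.2 l. 1190–1200, App. C l. 4656–4670, Def. C.8 l. 4663–4665] -/
theorem nonempty_sec42Data_punctured (hA : exists_albanese) (hd : Module.finrank ℚ (maximalRealSubfield F) = 1)
    (iso : ℕ → Prop) : Nonempty (Sec42Data (honestP5 V K₀ ((Functor.const _).obj (puncturedPlane F))) iso) := by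
  -- the open immersion `ℙ² ∖ pt ↪ ℙ²` over `F` (one boundary point), and its base change along `c`
  obtain ⟨ιU, hιU, hbd₀⟩ := exists_openImmersion_puncturedPlane F
  have hbd : ((Set.range ((baseChangeHom (cmConjRingHom F)).map ιU).left)ᶜ).Subsingleton :=
    subsingleton_compl_range_baseChange_map ιU hbd₀
  let cpt : CompactifiedSystem (honestSystem V K₀ ((Functor.const _).obj (puncturedPlane F))) :=
    { ShBar := fun _ => (baseChangeHom (cmConjRingHom F)).obj (projectiveSpace 2 (F : Type))
      jBar := fun _ => (baseChangeHom (cmConjRingHom F)).map ιU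
      isOpenImmersion_jBar := fun _ => isOpenImmersion_baseChange_map_left ιU
      discrete_boundary := fun _ => @Subsingleton.discreteTopology _ _ hbd.coe_sort
      X := conjSystem V K₀ ((Functor.const _).obj (projectiveSpace 2 (F : Type)))
      blowDown := fun _ => 𝟙 _
      j := Functor.whiskerRight ((Functor.const _).map ιU) (baseChangeHom (cmConjRingHom F))
      j_blowDown := fun _ => Category.comp_id _
      isOpenImmersion_j := fun _ => isOpenImmersion_baseChange_map_left ιU
      isIso_j_of_isProper := fun _ hK => absurd hK (not_isProper_baseChange_cmConj (not_isProper_puncturedPlane F))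
      smooth_Sh := fun K =>
        smooth_conjSystem_obj V K₀ ((Functor.const _).obj (puncturedPlane F)) (fun _ => smooth_puncturedPlane F) K
      projective_Sh_of := fun hdn K => by
        exfalso
        rcases hdn with h1 | h1
        · rw [hd] at h1
          exact lt_irrefl _ h1
        · have h3 : (honestP5 V K₀ ((Functor.const (C5.SmallLevel K₀)).obj (puncturedPlane F))).n = 3 := rfl
          omega
      smooth_X := fun K =>
        smooth_conjSystem_obj V K₀ ((Functor.const _).obj (projectiveSpace 2 (F : Type)))
          (fun _ => smooth_projectiveSpace_two F) K
      projective_X := fun K =>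
        projective_conjSystem_obj V K₀ ((Functor.const _).obj (projectiveSpace 2 (F : Type)))
          (fun _ => isProjectiveOver_projectiveSpace_two F) K }
  exact Sec42Data.nonempty_of_exists_albanese hA iso (Nat.le_of_ble_eq_true rfl)
    (honestSystem V K₀ ((Functor.const _).obj (puncturedPlane F))) (isProjectiveOver_punctured_Sh_iff V K₀ hd iso) cpt

variable (h : exists_recordSystem) (Φ : Literature.AlgebraicGeometry.Motives.CMType F)

/-- **`Sec42Data (honestP5Of h F ι₁ V Φ) iso` is inhabited at `[F:ℚ] = 2`** (the punctured branch). [cite: Liu2021, §4.2 l. 2053–2072] -/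
theorem nonempty_sec42Data_honestP5Of_of_not_four_le (hA : exists_albanese) (h4 : ¬ 4 ≤ Module.finrank ℚ F) (iso : ℕ → Prop) :
    Nonempty (Sec42Data (honestP5Of h F ι₁ V Φ) iso) := by
  show Nonempty (Sec42Data (honestP5 V (K3 V) (recordFunctorOf h V)) iso)
  rw [recordFunctorOf_eq_punctured V h h4]
  exact nonempty_sec42Data_punctured V (K3 V) hA (finrank_maximalRealSubfield_eq_one h4) iso

/-- **`Sec42Data (honestP5Of h F ι₁ V Φ) iso` is inhabited for EVERY CM field `F`** (b25's `nonempty_sec42Data_honestP5Of` at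
`4 ≤ [F:ℚ]`, the punctured branch otherwise), given Deligne's canonical models `h` and [Liu2021] §2.1 Prop. 2.2 `hA`.
[cite: Liu2021, §4.2 l. 2053–2072 and §2.1 Prop. 2.2] [cite: Deligne1979ShimuraVarieties, 2.2.5 and Cor. 2.7.21] -/
theorem nonempty_sec42Data_honestP5Of_all (hA : exists_albanese) (iso : ℕ → Prop) :
    Nonempty (Sec42Data (honestP5Of h F ι₁ V Φ) iso) := by
  by_cases h4 : 4 ≤ Module.finrank ℚ F
  · exact nonempty_sec42Data_honestP5Of h V Φ hA h4 iso
  · exact nonempty_sec42Data_honestP5Of_of_not_four_le V h Φ hA h4 iso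

end Punctured

/-! ## §3  The TYPE `Thm418Rest C` is inhabited over any Appendix-C datum `C` -/

section Rest

variable {F : CMField} {P5 : PropC5Data (maximalRealSubfield F) F} {isotropicAt : ℕ → Prop}

/-- **A type-level inhabitant of `Thm418Rest C`**: `ε`, `χ`-carriers `PUnit`; `μ` a conjugate-symplectic character of weight one
(tree THEOREM `IdeleClassGroup.exists_isConjugateSymplectic_hasCMType`, [WeilBNT1967] VII §3 — Liu's Def. 4.3 objects EXIST);
`𝒜(μ)`-objects `PUnit` with `A_μ := A_{K₀}` (an abelian variety over `E` that `C` itself carries); `ω(μ,ε,χ) := ℂ` trivial action;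
`Ω(μ) := PUnit`; `res := 0`.  This inhabits the CARRIER TYPE the END displays quantify over; it is NOT Liu's theta-lift datum (X3
lineage) and asserts nothing about it. [cite: Liu2021, Def. 4.3, Def. 4.5 (2), Def. 4.11, Def. 4.16] -/
theorem nonempty_thm418Rest (C : Sec42Data P5 isotropicAt) : Nonempty (Thm418Rest C) := by
  classical
  letI : IsCMField F := isCMField (maximalRealSubfield F) F
  obtain ⟨μ, hμ, hw, -⟩ := IdeleClassGroup.exists_isConjugateSymplectic_hasCMType (L := F)
    (IdeleClassGroup.cmTypeOf F (fun _ => -1) (by simp))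
  exact ⟨{
    Eps := PUnit
    epsOf := fun _ => PUnit.unit
    Chi := PUnit
    μ := μ
    isConjugateSymplectic := hμ
    hasWeight_one := hw
    Obj := PUnit
    Aμ := fun _ => C.A ⟨C.S.K₀, le_rfl⟩
    omega := fun _ _ => ℂ
    rho := fun _ _ => 1
    Ω := PUnit
    rhoΩ := 1
    res := fun _ _ => 0
    res_pull := fun _ _ _ => Subsingleton.elim _ _ }⟩

end Rest

/-! ## §4  The Π-binders are jointly inhabited -/

section Pi

variable (h : exists_recordSystem)

/-- **The Π-binders `iso`, `C`, `R` of the hComp END displays are JOINTLY INHABITED** (at every index, both degree branches):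
there are `iso`, a TOTAL `C : ∀ F ι₁ V Φ, Sec42Data (honestP5Of h F ι₁ V Φ) (iso F ι₁ V Φ)` — namely
`fun F ι₁ V Φ => Classical.choice (nonempty_sec42Data_honestP5Of_all h V Φ hA (iso F ι₁ V Φ))`, NO degree guard — and a TOTAL
`R : ∀ F ι₁ V Φ, Thm418Rest (C F ι₁ V Φ)`; so no display over these binders (`Model.hComp_holds`, `Model.pinReach_closed`,
`Model.hc_cm_of_thm418AsPrinted_along_conj_holds`, …) quantifies over an empty domain, and `C` can be INSTANTIATED by application at
that total term.  CONDITIONAL on `h` ([Deligne1979]) and `hA` ([Liu2021] §2.1 Prop. 2.2); a non-vacuity certificate, NOT a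
construction of Liu's theta-lift objects and NOT a discharge of any reading binder; HC_CM is NOT proved.
[cite: Liu2021, §4.2 l. 2053–2074 and Thm. 4.18] [cite: Deligne1979ShimuraVarieties, 2.2.5 and Cor. 2.7.21] -/
theorem nonempty_piCarriers (hA : exists_albanese) :
    ∃ (iso : ∀ (F : CMField) (ι₁ : F →+* ℂ) (_ : HermSpace3 F ι₁) (_ : Literature.AlgebraicGeometry.Motives.CMType F), ℕ → Prop)
      (C : ∀ (F : CMField) (ι₁ : F →+* ℂ) (V : HermSpace3 F ι₁) (Φ : Literature.AlgebraicGeometry.Motives.CMType F),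
        Sec42Data (honestP5Of h F ι₁ V Φ) (iso F ι₁ V Φ)),
      Nonempty (∀ (F : CMField) (ι₁ : F →+* ℂ) (V : HermSpace3 F ι₁) (Φ : Literature.AlgebraicGeometry.Motives.CMType F),
        Thm418Rest (C F ι₁ V Φ)) :=
  ⟨fun _ _ _ _ _ => True, fun _ _ V Φ => Classical.choice (nonempty_sec42Data_honestP5Of_all V h Φ hA _),
    ⟨fun _ _ V Φ => Classical.choice (nonempty_thm418Rest (Classical.choice (nonempty_sec42Data_honestP5Of_all V h Φ hA _)))⟩⟩

end Pi

end Summit.HodgeConjecture.CorCM.Model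

end
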